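import Mathlib
import HarnessLib
import Literature.MathematicalPhysics.KineticTheory.HardSphereEulerProofs

/-!
# Static fibre exponential moments under the local Gibbs measure
# (stub `stub_fibreExpMoment` of line `Sketch` for the crux `KineticCurrentsWindowLDUniform`,
# stmt-AtomisticToContinuum-14662)

Helper file for the registered stub `stub_fibreExpMoment` (S2) of the line skeleton
`Cruxes/KineticCurrentsWindowLDUniform/Lines/Sketch.lean`.

Let `λ = localGibbsMeasure σ a u₀ θ₀ N` be the local Gibbs law of `N + 1` hard spheres on `𝕋³`
(density `Z⁻¹ 𝟙_{no overlap}(x) ∏ᵢ a(xᵢ) M_{1,u₀(xᵢ),θ₀(xᵢ)}(vᵢ)`).  GIVEN THE POSITIONS the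
velocities are independent Gaussians `N(u₀(xᵢ), θ₀(xᵢ) id)`
(`lintegral_localGibbsMeasure`, `velMeasure`), so for a measurable one-body factor `g ≥ 0` with
`∫ g(x, v) M_{1,u₀(x),θ₀(x)}(v) dv ≤ K` at every `x`, the product `∏ᵢ g(zᵢ)` integrates fibrewise
to `∏ᵢ ∫ g(xᵢ, ·) dN(u₀(xᵢ), θ₀(xᵢ)) ≤ K^{N+1}` (Tonelli on the finite product,
`M_{1,u,θ} dv = N(u, θ id)`), and the positions then integrate to `1` because `λ` is a probability
measure for `σ ≤ 1/2` (`isProbabilityMeasure_localGibbsMeasure`, `lintegral_posWeight_eq_one`).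

References: H. Spohn, *Large Scale Dynamics of Interacting Particles* (1991), Part I §2.3 (local
equilibrium states); the disintegration API is `HardSphereEulerProofs.lean`.
-/

noncomputable section

open MeasureTheory Set Filter
open scoped ENNReal Topology

namespace Summit.AtomisticToContinuum.HydrodynamicLimit.Theorems.KineticCurrentsWindowLDUniformSketch

open Literature.Analysis.FluidPDE (HardSphereFlow Config localMaxwellian)
open Literature.MathematicalPhysics.KineticTheory (T3 V3 hsDiameter localGibbsLaw localGibbsMeasure)
open Literature.MathematicalPhysics.KineticTheory

/-- **S2 — static fibre exponential moments under the local Gibbs measure** (registered stub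
`stub_fibreExpMoment` of line `Sketch`, crux stmt-AtomisticToContinuum-14662).  For continuous
profiles `a, θ₀ > 0`, `u₀`, reduced density `0 < σ ≤ 1/2`, a measurable one-body factor
`g : 𝕋³ × ℝ³ → [0, ∞]` whose local-Maxwellian fibre integrals are bounded by `K` at every position,
the local Gibbs expectation of `∏ᵢ g(zᵢ)` is at most `K^{N+1}`: disintegrate into positions and
velocities (`lintegral_localGibbsMeasure`), use Tonelli on the Gaussian product fibre
(`lintegral_fintype_prod_eq_prod'`, `withDensity_localMaxwellian_eq_gaussMeasure`), bound each
factor by `K`, and integrate the normalised position weight to `1` (`lintegral_posWeight_eq_one`). -/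
theorem stub_fibreExpMoment :
    ∀ (a θ₀ : T3 → ℝ) (u₀ : T3 → V3), Continuous a → Continuous θ₀ → Continuous u₀ →
      (∀ x, 0 < a x) → (∀ x, 0 < θ₀ x) → ∀ σ : ℝ, 0 < σ → σ ≤ 1 / 2 → ∀ N : ℕ,
      ∀ g : T3 × V3 → ℝ≥0∞, Measurable g → ∀ K : ℝ≥0∞,
      (∀ x : T3, ∫⁻ v, g (x, v) * ENNReal.ofReal (localMaxwellian 1 (θ₀ x) (u₀ x) v) ≤ K) →
        ∫⁻ z, ∏ i, g (z i) ∂(localGibbsMeasure σ a u₀ θ₀ N) ≤ K ^ (N + 1) := by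
  intro a θ₀ u₀ ha hθ hu ha0 hθ0 σ _hσ hσ2 N g hg K hK
  have ha0' : ∀ x, 0 ≤ a x := fun x => (ha0 x).le
  haveI := isProbabilityMeasure_localGibbsMeasure ha hθ hu ha0 hθ0 hσ2 N
  -- the integrand is measurable
  have hGm : Measurable fun z : Config (N + 1) (Fin 3) T3 => ∏ i, g (z i) :=
    Finset.measurable_prod _ fun i _ => hg.comp (measurable_pi_apply i)
  -- one-body fibre integrals: `∫ g(x, ·) dN(u₀ x, θ₀ x) = ∫ g(x, v) M(v) dv ≤ K`
  have hfib : ∀ x : T3, ∫⁻ w, g (x, w) ∂gaussMeasure (u₀ x) (θ₀ x) ≤ K := by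
    intro x
    have hgx : Measurable fun w : V3 => g (x, w) := hg.comp measurable_prodMk_left
    have hM : Measurable fun w : V3 => ENNReal.ofReal (localMaxwellian 1 (θ₀ x) (u₀ x) w) :=
      (continuous_localMaxwellian 1 (θ₀ x) (u₀ x)).measurable.ennreal_ofReal
    rw [← withDensity_localMaxwellian_eq_gaussMeasure (hθ0 x) (u₀ x),
      lintegral_withDensity_eq_lintegral_mul _ hM hgx]
    calc ∫⁻ w, ((fun w => ENNReal.ofReal (localMaxwellian 1 (θ₀ x) (u₀ x) w)) *
            fun w => g (x, w)) w
        = ∫⁻ w, g (x, w) * ENNReal.ofReal (localMaxwellian 1 (θ₀ x) (u₀ x) w) :=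
          lintegral_congr fun w => mul_comm _ _
      _ ≤ K := hK x
  -- conditional (velocity) bound, uniformly in the positions
  have hvel : ∀ x : Fin (N + 1) → T3,
      ∫⁻ v, (∏ i, g (zipConfig (x, v) i)) ∂velMeasure u₀ θ₀ x ≤ K ^ (N + 1) := by
    intro x
    have h1 : ∫⁻ v, (∏ i, g (zipConfig (x, v) i)) ∂velMeasure u₀ θ₀ x =
        ∏ i, ∫⁻ w, g (x i, w) ∂gaussMeasure (u₀ (x i)) (θ₀ (x i)) := by
      simp only [zipConfig_apply, velMeasure]
      exact lintegral_fintype_prod_eq_prod' (fun i => gaussMeasure (u₀ (x i)) (θ₀ (x i)))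
        (f := fun i w => g (x i, w)) (fun i => hg.comp measurable_prodMk_left)
    rw [h1]
    calc ∏ i, ∫⁻ w, g (x i, w) ∂gaussMeasure (u₀ (x i)) (θ₀ (x i))
        ≤ ∏ _i : Fin (N + 1), K := Finset.prod_le_prod' fun i _ => hfib (x i)
      _ = K ^ (N + 1) := by rw [Finset.prod_const, Finset.card_univ, Fintype.card_fin]
  -- the normalised position weight is measurable and integrates to one
  have hρm : Measurable fun x : Fin (N + 1) → T3 => ENNReal.ofReal
      ((Literature.Analysis.FluidPDE.canonicalPartition
          (Literature.Analysis.FluidPDE.Torus.geometry (Fin 3)) (hsDiameter σ N) (N + 1)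
          (localGibbsProfile a u₀ θ₀))⁻¹ * posWeight a (hsDiameter σ N) (N + 1) x) :=
    (measurable_const.mul (measurable_posWeight ha _ _)).ennreal_ofReal
  calc ∫⁻ z, ∏ i, g (z i) ∂(localGibbsMeasure σ a u₀ θ₀ N)
      = ∫⁻ x, ENNReal.ofReal ((Literature.Analysis.FluidPDE.canonicalPartition
            (Literature.Analysis.FluidPDE.Torus.geometry (Fin 3)) (hsDiameter σ N) (N + 1)
            (localGibbsProfile a u₀ θ₀))⁻¹ * posWeight a (hsDiameter σ N) (N + 1) x) *
          ∫⁻ v, (∏ i, g (zipConfig (x, v) i)) ∂velMeasure u₀ θ₀ x :=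
        lintegral_localGibbsMeasure ha hθ hu ha0' hθ0 σ N hGm
    _ ≤ ∫⁻ x, ENNReal.ofReal ((Literature.Analysis.FluidPDE.canonicalPartition
            (Literature.Analysis.FluidPDE.Torus.geometry (Fin 3)) (hsDiameter σ N) (N + 1)
            (localGibbsProfile a u₀ θ₀))⁻¹ * posWeight a (hsDiameter σ N) (N + 1) x) *
          K ^ (N + 1) :=
        lintegral_mono fun x => mul_le_mul_right (hvel x) _
    _ = K ^ (N + 1) := by
        rw [lintegral_mul_const _ hρm, lintegral_posWeight_eq_one ha hθ hu ha0' hθ0 σ N, one_mul]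

end Summit.AtomisticToContinuum.HydrodynamicLimit.Theorems.KineticCurrentsWindowLDUniformSketch
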